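import Mathlib
import Literature.NumberTheory.LFunctions.Zhang2022.Section14Summability
import HarnessLib

/-!
# Zhang (2022) §14: the deduction node of (14.5), kernel-checked (D15 / cone C36)

Topic `Literature/NumberTheory/LFunctions/Zhang2022` (Landau–Siegel audit tree; verdict-neutral).
Y. Zhang, *Discrete mean estimates and the Landau–Siegel zero*, arXiv:2211.02515v1 (2022)
[Zhang2022LandauSiegel] — **an unrefereed manuscript under adjudication**; this file PROVES a printed
inference between the typed claims of §14 (`TypedSection14.lean`, L3-t7); it does not assert the claims
themselves and says nothing about Theorems 1–2.

* `dedEq145_holds : Typed.Sec14.DedEq145` — DAG node `Z22:(14.5).pf` [Z22 pp.78–79, tex L3918–L3950]: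
  "By the above discussion, to complete the proof of (14.5), it now suffices to show … (14.8)", i.e.
  (14.7) ∧ u013 ∧ u015 ∧ (14.8) ⇒ (14.5). Kernel-supplied bookkeeping: the sum over `θ (mod Dk)` in
  (14.7) splits as `ψ⁰ + θ_k¹ + rest` (`calS_one_split`; `θ_k¹ ≠ ψ⁰`, `θ̄_k¹ = θ_k¹`, `θ_k¹(−l) = 0`
  unless `(l,Dk) = 1`), `χ(p)χ(−p) = χ(−1)` on the window (`p > D`), `≤ 3P` primes in the window for
  the principal terms (u013: `≪ P𝓛ᶜ` each), and — the one analytic input print leaves implicit — the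
  absolute convergence of the `l`-series (`Section14Summability.summable_kappa_mul_DeltaW`), which
  licenses exchanging `Σ_{p∼P}` with `Σ_l` (`sum_window_tsum_exchange`) so that the remaining
  characters contribute at most the left side of (14.8) (`norm_sum_window_rest_le`, `|θ(−1)| ≤ 1`);
  finally `P²𝓛ᶜ + P²D^{−c₈} ≤ C·P²D^{1/2−c}` with `c = min(c₈, 1/4)`.

## References

* Y. Zhang, arXiv:2211.02515v1 (2022), §14 pp. 78–79, (14.5), (14.7), (14.8), u013–u015.
  [cite: Zhang2022LandauSiegel, §14 (14.5) (proof) pp.78–79]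
-/

noncomputable section

open Complex Real ComplexConjugate

namespace Literature.NumberTheory.LFunctions.Zhang2022.Typed.Sec14

open Skeleton Filter

/-! ### The deduction node of (14.5) -/

section Eq145

variable {D : ℕ} [NeZero D] (χ : DirichletCharacter ℂ D)

omit [NeZero D] χ in
/-- Three-way distribution of a double sum. [folklore] -/
private theorem sum_mul_sum_add3 (I J : Finset ℕ) (a : ℕ → ℂ) (x y z : ℕ → ℕ → ℂ) :
    ∑ d ∈ I, a d * ∑ k ∈ J, (x d k + y d k + z d k) =
      (∑ d ∈ I, a d * ∑ k ∈ J, x d k) + (∑ d ∈ I, a d * ∑ k ∈ J, y d k) +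
        ∑ d ∈ I, a d * ∑ k ∈ J, z d k := by
  simp only [Finset.sum_add_distrib, mul_add]

/-- **The per-`p` decomposition of `𝒮(1,D;p)`** along `θ = ψ⁰`, `θ = θ_k¹`, `θ` otherwise, from the
(14.7)-identity and the u015-identity at `p`. [cite: Zhang2022LandauSiegel, §14 (14.7), u013–u015 pp.78] -/
theorem calS_one_split (hq : χ.IsQuadratic) (hp : χ.IsPrimitive) (hD : D ≠ 1) (p : ℕ)
    (κs as : ℕ → ℂ)
    (h147 : calS D 1 D p κs as =
      ∑ d ∈ Finset.Icc 1 ⌊2 * P4 D⌋₊, (d : ℂ)⁻¹ * ∑ k ∈ Finset.Icc 1 ⌊2 * P4 D⌋₊,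
        as (d * k) / ((k : ℂ) * Nat.totient (D * k)) *
          ∑ θ ∈ finsetOf (Set.univ : Set (DirichletCharacter ℂ (D * k))),
            tauSum (D * k) θ⁻¹ * θ⁻¹ (p : ZMod (D * k)) *
              ∑' l : ℕ, κs (d * l) * θ (-(l : ZMod (D * k))) * DeltaW D ((l : ℝ) / ((D : ℝ) * p * k)))
    (h15 : (∑ d ∈ Finset.Icc 1 ⌊2 * P4 D⌋₊, (d : ℂ)⁻¹ * ∑ k ∈ Finset.Icc 1 ⌊2 * P4 D⌋₊,
        ∑' l : ℕ, if Nat.Coprime l (D * k) then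
          κs (d * l) * as (d * k) / ((Nat.totient (D * k) : ℂ) * k) *
            DeltaW D ((l : ℝ) / ((D : ℝ) * p * k)) *
              (tauSum (D * k) (thetaOne χ k) * thetaOne χ k (p : ZMod (D * k)) *
                thetaOne χ k (-(l : ZMod (D * k)))) else 0) =
      χ (-(p : ZMod D)) * GammaFactor.tau χ / Nat.totient D * mainSum14 χ p κs as) :
    calS D 1 D p κs as = princ147 D p κs as +
      χ (-(p : ZMod D)) * GammaFactor.tau χ / Nat.totient D * mainSum14 χ p κs as +
      ∑ d ∈ Finset.Icc 1 ⌊2 * P4 D⌋₊, (d : ℂ)⁻¹ * ∑ k ∈ Finset.Icc 1 ⌊2 * P4 D⌋₊,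
        as (d * k) / ((k : ℂ) * Nat.totient (D * k)) *
          ∑ θ ∈ finsetOf {θ : DirichletCharacter ℂ (D * k) | θ ≠ 1 ∧ θ ≠ thetaOne χ k},
            tauSum (D * k) θ⁻¹ * θ⁻¹ (p : ZMod (D * k)) *
              ∑' l : ℕ, κs (d * l) * θ (-(l : ZMod (D * k))) * DeltaW D ((l : ℝ) / ((D : ℝ) * p * k)) := by
  rw [h147, ← h15, princ147, ← sum_mul_sum_add3]
  refine Finset.sum_congr rfl fun d _ => ?_
  congr 1
  refine Finset.sum_congr rfl fun k hk => ?_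
  have hk0 : k ≠ 0 := by have := (Finset.mem_Icc.mp hk).1; omega
  haveI : NeZero (D * k) := ⟨mul_ne_zero (NeZero.ne D) hk0⟩
  rw [sum_characters_split (thetaOne χ k) (thetaOne_ne_one χ hp hD hk0), mul_add, mul_add]
  congr 1
  congr 1
  -- the `θ_k¹` term is the u015 summand
  rw [thetaOne_inv χ hq, ← mul_assoc, ← tsum_mul_left]
  refine tsum_congr fun l => ?_
  by_cases hl : Nat.Coprime l (D * k)
  · rw [if_pos hl]; ring
  · rw [if_neg hl, apply_neg_natCast_eq_zero _ hl]; ring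

omit [NeZero D] in
/-- **Exchanging `Σ_{p∼P}` with the `l`-series** (absolutely convergent by `summable_kappa_mul_DeltaW`),
and `θ(−l) = θ(−1)θ(l)`. [cite: Zhang2022LandauSiegel, §14 (14.8) p.79] -/
theorem sum_window_tsum_exchange (hD : 3 ≤ D) {B : ℝ} {κs : ℕ → ℂ} (hκ : Eq141 B κs)
    (d k : ℕ) (hk : 1 ≤ k) (θ : DirichletCharacter ℂ (D * k)) :
    ∑ p ∈ primeWindow D, χ (p : ZMod D) * θ⁻¹ (p : ZMod (D * k)) *
        ∑' l : ℕ, κs (d * l) * θ (-(l : ZMod (D * k))) * DeltaW D ((l : ℝ) / ((D : ℝ) * p * k)) =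
      θ (-1) * ∑' l : ℕ, κs (d * l) * θ (l : ZMod (D * k)) *
        ∑ p ∈ primeWindow D, χ (p : ZMod D) * θ⁻¹ (p : ZMod (D * k)) *
          DeltaW D ((l : ℝ) / ((D : ℝ) * p * k)) := by
  have hsum : ∀ p ∈ primeWindow D, Summable fun l : ℕ =>
      χ (p : ZMod D) * θ⁻¹ (p : ZMod (D * k)) *
        (κs (d * l) * θ (-(l : ZMod (D * k))) * DeltaW D ((l : ℝ) / ((D : ℝ) * p * k))) := by
    intro p hp
    have hp0 : (0 : ℝ) < p := by exact_mod_cast (Finset.mem_filter.mp hp).2.pos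
    have hD0 : (0 : ℝ) < D := by exact_mod_cast (show 0 < D by omega)
    have hk0 : (0 : ℝ) < k := by exact_mod_cast hk
    have hQ : (0 : ℝ) < (D : ℝ) * p * k := by positivity
    exact (summable_kappa_mul_DeltaW hD hκ d hQ (g := fun l => θ (-(l : ZMod (D * k))))
      (G := 1) (fun l => DirichletCharacter.norm_le_one θ _)).mul_left _
  calc ∑ p ∈ primeWindow D, χ (p : ZMod D) * θ⁻¹ (p : ZMod (D * k)) *
        ∑' l : ℕ, κs (d * l) * θ (-(l : ZMod (D * k))) * DeltaW D ((l : ℝ) / ((D : ℝ) * p * k))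
      = ∑ p ∈ primeWindow D, ∑' l : ℕ, χ (p : ZMod D) * θ⁻¹ (p : ZMod (D * k)) *
          (κs (d * l) * θ (-(l : ZMod (D * k))) * DeltaW D ((l : ℝ) / ((D : ℝ) * p * k))) := by
        refine Finset.sum_congr rfl fun p _ => ?_
        rw [tsum_mul_left]
    _ = ∑' l : ℕ, ∑ p ∈ primeWindow D, χ (p : ZMod D) * θ⁻¹ (p : ZMod (D * k)) *
          (κs (d * l) * θ (-(l : ZMod (D * k))) * DeltaW D ((l : ℝ) / ((D : ℝ) * p * k))) :=
        (Summable.tsum_finsetSum hsum).symm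
    _ = ∑' l : ℕ, θ (-1) * (κs (d * l) * θ (l : ZMod (D * k)) *
          ∑ p ∈ primeWindow D, χ (p : ZMod D) * θ⁻¹ (p : ZMod (D * k)) *
            DeltaW D ((l : ℝ) / ((D : ℝ) * p * k))) := by
        refine tsum_congr fun l => ?_
        have hneg : θ (-(l : ZMod (D * k))) = θ (-1) * θ (l : ZMod (D * k)) := by
          rw [← map_mul, neg_one_mul]
        rw [Finset.mul_sum, Finset.mul_sum]
        refine Finset.sum_congr rfl fun p _ => ?_
        rw [hneg]; ring
    _ = _ := tsum_mul_left

omit [NeZero D] in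
/-- **The rest term of (14.7) summed over the window is bounded by the left side of (14.8).**
[cite: Zhang2022LandauSiegel, §14 (14.8) p.79] -/
theorem norm_sum_window_rest_le (hD : 3 ≤ D) {B : ℝ} {κs : ℕ → ℂ} (hκ : Eq141 B κs)
    (as : ℕ → ℂ) :
    ‖∑ p ∈ primeWindow D, χ (p : ZMod D) *
        ∑ d ∈ Finset.Icc 1 ⌊2 * P4 D⌋₊, (d : ℂ)⁻¹ * ∑ k ∈ Finset.Icc 1 ⌊2 * P4 D⌋₊,
          as (d * k) / ((k : ℂ) * Nat.totient (D * k)) *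
            ∑ θ ∈ finsetOf {θ : DirichletCharacter ℂ (D * k) | θ ≠ 1 ∧ θ ≠ thetaOne χ k},
              tauSum (D * k) θ⁻¹ * θ⁻¹ (p : ZMod (D * k)) *
                ∑' l : ℕ, κs (d * l) * θ (-(l : ZMod (D * k))) *
                  DeltaW D ((l : ℝ) / ((D : ℝ) * p * k))‖ ≤ lhs148 χ κs as := by
  -- move the `p`-sum inside
  have hre : ∑ p ∈ primeWindow D, χ (p : ZMod D) *
        ∑ d ∈ Finset.Icc 1 ⌊2 * P4 D⌋₊, (d : ℂ)⁻¹ * ∑ k ∈ Finset.Icc 1 ⌊2 * P4 D⌋₊,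
          as (d * k) / ((k : ℂ) * Nat.totient (D * k)) *
            ∑ θ ∈ finsetOf {θ : DirichletCharacter ℂ (D * k) | θ ≠ 1 ∧ θ ≠ thetaOne χ k},
              tauSum (D * k) θ⁻¹ * θ⁻¹ (p : ZMod (D * k)) *
                ∑' l : ℕ, κs (d * l) * θ (-(l : ZMod (D * k))) *
                  DeltaW D ((l : ℝ) / ((D : ℝ) * p * k)) =
      ∑ d ∈ Finset.Icc 1 ⌊2 * P4 D⌋₊, (d : ℂ)⁻¹ * ∑ k ∈ Finset.Icc 1 ⌊2 * P4 D⌋₊,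
          as (d * k) / ((k : ℂ) * Nat.totient (D * k)) *
            ∑ θ ∈ finsetOf {θ : DirichletCharacter ℂ (D * k) | θ ≠ 1 ∧ θ ≠ thetaOne χ k},
              tauSum (D * k) θ⁻¹ * (θ (-1) * ∑' l : ℕ, κs (d * l) * θ (l : ZMod (D * k)) *
                ∑ p ∈ primeWindow D, χ (p : ZMod D) * θ⁻¹ (p : ZMod (D * k)) *
                  DeltaW D ((l : ℝ) / ((D : ℝ) * p * k))) := by
    -- both sides equal the quadruple sum with `p` innermost
    have lhs : ∑ p ∈ primeWindow D, χ (p : ZMod D) *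
        ∑ d ∈ Finset.Icc 1 ⌊2 * P4 D⌋₊, (d : ℂ)⁻¹ * ∑ k ∈ Finset.Icc 1 ⌊2 * P4 D⌋₊,
          as (d * k) / ((k : ℂ) * Nat.totient (D * k)) *
            ∑ θ ∈ finsetOf {θ : DirichletCharacter ℂ (D * k) | θ ≠ 1 ∧ θ ≠ thetaOne χ k},
              tauSum (D * k) θ⁻¹ * θ⁻¹ (p : ZMod (D * k)) *
                ∑' l : ℕ, κs (d * l) * θ (-(l : ZMod (D * k))) *
                  DeltaW D ((l : ℝ) / ((D : ℝ) * p * k)) =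
        ∑ d ∈ Finset.Icc 1 ⌊2 * P4 D⌋₊, ∑ k ∈ Finset.Icc 1 ⌊2 * P4 D⌋₊,
          ∑ θ ∈ finsetOf {θ : DirichletCharacter ℂ (D * k) | θ ≠ 1 ∧ θ ≠ thetaOne χ k},
            (d : ℂ)⁻¹ * (as (d * k) / ((k : ℂ) * Nat.totient (D * k))) * tauSum (D * k) θ⁻¹ *
              ∑ p ∈ primeWindow D, χ (p : ZMod D) * θ⁻¹ (p : ZMod (D * k)) *
                ∑' l : ℕ, κs (d * l) * θ (-(l : ZMod (D * k))) *
                  DeltaW D ((l : ℝ) / ((D : ℝ) * p * k)) := by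
      simp only [Finset.mul_sum]
      rw [Finset.sum_comm]
      refine Finset.sum_congr rfl fun d _ => ?_
      rw [Finset.sum_comm]
      refine Finset.sum_congr rfl fun k _ => ?_
      rw [Finset.sum_comm]
      refine Finset.sum_congr rfl fun θ _ => Finset.sum_congr rfl fun p _ => ?_
      ring
    rw [lhs]
    have step : ∀ d ∈ Finset.Icc 1 ⌊2 * P4 D⌋₊, ∀ k ∈ Finset.Icc 1 ⌊2 * P4 D⌋₊,
        ∀ θ ∈ finsetOf {θ : DirichletCharacter ℂ (D * k) | θ ≠ 1 ∧ θ ≠ thetaOne χ k},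
        (d : ℂ)⁻¹ * (as (d * k) / ((k : ℂ) * Nat.totient (D * k))) * tauSum (D * k) θ⁻¹ *
            ∑ p ∈ primeWindow D, χ (p : ZMod D) * θ⁻¹ (p : ZMod (D * k)) *
              ∑' l : ℕ, κs (d * l) * θ (-(l : ZMod (D * k))) *
                DeltaW D ((l : ℝ) / ((D : ℝ) * p * k)) =
          (d : ℂ)⁻¹ * (as (d * k) / ((k : ℂ) * Nat.totient (D * k)) *
            (tauSum (D * k) θ⁻¹ * (θ (-1) * ∑' l : ℕ, κs (d * l) * θ (l : ZMod (D * k)) *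
              ∑ p ∈ primeWindow D, χ (p : ZMod D) * θ⁻¹ (p : ZMod (D * k)) *
                DeltaW D ((l : ℝ) / ((D : ℝ) * p * k))))) := by
      intro d _ k hk θ _
      have hk1 : 1 ≤ k := (Finset.mem_Icc.mp hk).1
      rw [sum_window_tsum_exchange χ hD hκ d k hk1 θ]
      ring
    rw [Finset.sum_congr rfl fun d hd => Finset.sum_congr rfl fun k hk =>
      Finset.sum_congr rfl fun θ hθ => step d hd k hk θ hθ]
    simp only [← Finset.mul_sum]
  rw [hre, lhs148]
  -- termwise norm bounds through the three finite sums
  refine (norm_sum_le _ _).trans (Finset.sum_le_sum fun d _ => ?_)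
  rw [norm_mul, norm_inv, Complex.norm_natCast]
  refine mul_le_mul_of_nonneg_left ?_ (by positivity)
  refine (norm_sum_le _ _).trans (Finset.sum_le_sum fun k _ => ?_)
  rw [norm_mul, norm_div, norm_mul, Complex.norm_natCast, Complex.norm_natCast, mul_comm (k : ℝ)]
  refine mul_le_mul_of_nonneg_left ?_ (by positivity)
  refine (norm_sum_le _ _).trans (Finset.sum_le_sum fun θ _ => ?_)
  rw [norm_mul, norm_mul]
  refine mul_le_mul_of_nonneg_left ?_ (norm_nonneg _)
  calc ‖θ (-1)‖ * ‖∑' l : ℕ, κs (d * l) * θ (l : ZMod (D * k)) *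
          ∑ p ∈ primeWindow D, χ (p : ZMod D) * θ⁻¹ (p : ZMod (D * k)) *
            DeltaW D ((l : ℝ) / ((D : ℝ) * p * k))‖
      ≤ 1 * ‖∑' l : ℕ, κs (d * l) * θ (l : ZMod (D * k)) *
          ∑ p ∈ primeWindow D, χ (p : ZMod D) * θ⁻¹ (p : ZMod (D * k)) *
            DeltaW D ((l : ℝ) / ((D : ℝ) * p * k))‖ := by
        gcongr; exact DirichletCharacter.norm_le_one θ _
    _ = _ := one_mul _

end Eq145

/-- `Z22:(14.5).pf` DISCHARGED (the printed inference): **(14.7) ∧ u013 ∧ u015 ∧ (14.8) ⇒ (14.5)**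
("By the above discussion, to complete the proof of (14.5), it now suffices to show … (14.8)", p. 79).
Bookkeeping supplied by the kernel: in (14.7) the sum over `θ (mod Dk)` splits into `θ = ψ⁰` (the term
`princ147`, `≪ P𝓛ᶜ` each by u013, `≤ 3P` primes in the window), `θ = θ_k¹` (u015; `θ_k¹ ≠ ψ⁰`,
`θ̄_k¹ = θ_k¹`, `θ_k¹(−l) = 0` unless `(l,Dk) = 1`; then `χ(p)χ(−p) = χ(−1)` on the window) and the
rest, whose `p`-sum is bounded by the left side of (14.8) after exchanging `Σ_{p∼P}` with the
`l`-series (absolutely convergent: `summable_kappa_mul_DeltaW`) and `|θ(−1)| ≤ 1`; finally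
`P²𝓛ᶜ + P²D^{−c₈} ≤ C·P²D^{1/2−c}` with `c = min(c₈, 1/4)`.
[cite: Zhang2022LandauSiegel, §14 (14.5) (proof) pp.78–79, tex L3918–L3950] -/
theorem dedEq145_holds : DedEq145 := by
  intro h147 h13a h13b h15 h148 B
  obtain ⟨Ca, ha⟩ := h13a B
  obtain ⟨cb, Cb, hb⟩ := h13b B
  obtain ⟨c₈, hc₈, C₈, h8⟩ := h148 B
  set c : ℝ := min c₈ (1 / 4) with hc_def
  refine ⟨c, lt_min hc₈ (by norm_num), 3 * |Ca| * |Cb| + |C₈|, ?_⟩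
  obtain ⟨D₀, hall⟩ := ((((h147 B).and ha).and hb).and (h15 B)).and h8
  obtain ⟨D₁, hD₁⟩ := eventually_log_rpow_le_rpow_quarter cb
  refine ⟨max (max D₀ D₁) 3, fun D _ χ hD hq hp hA κs as hκ has => ?_⟩
  have hD0 : D₀ ≤ D := le_trans (le_trans (le_max_left _ _) (le_max_left _ _)) hD
  have hD1 : D₁ ≤ D := le_trans (le_trans (le_max_right _ _) (le_max_left _ _)) hD
  have hD3 : 3 ≤ D := le_trans (le_max_right _ _) hD
  obtain ⟨⟨⟨⟨e147, ea⟩, eb⟩, e15⟩, e8⟩ := hall D χ hD0 hq hp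
  have hDne1 : D ≠ 1 := by omega
  have hDpos : (0 : ℝ) < D := by exact_mod_cast (show 0 < D by omega)
  have hD1' : (1 : ℝ) ≤ D := by exact_mod_cast (show 1 ≤ D by omega)
  have hP0 : 0 ≤ bigP D := (Real.exp_pos _).le
  -- per-`p` decomposition and the main term
  have hsplit : ∀ p ∈ primeWindow D, χ (p : ZMod D) * calS D 1 D p κs as =
      χ (p : ZMod D) * princ147 D p κs as +
      χ (-1) * GammaFactor.tau χ / Nat.totient D * mainSum14 χ p κs as +
      χ (p : ZMod D) * ∑ d ∈ Finset.Icc 1 ⌊2 * P4 D⌋₊, (d : ℂ)⁻¹ * ∑ k ∈ Finset.Icc 1 ⌊2 * P4 D⌋₊,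
        as (d * k) / ((k : ℂ) * Nat.totient (D * k)) *
          ∑ θ ∈ finsetOf {θ : DirichletCharacter ℂ (D * k) | θ ≠ 1 ∧ θ ≠ thetaOne χ k},
            tauSum (D * k) θ⁻¹ * θ⁻¹ (p : ZMod (D * k)) *
              ∑' l : ℕ, κs (d * l) * θ (-(l : ZMod (D * k))) *
                DeltaW D ((l : ℝ) / ((D : ℝ) * p * k)) := by
    intro p hpW
    rw [calS_one_split χ hq hp hDne1 p κs as (e147 p hpW κs as hκ has) (e15 p hpW κs as hκ has)]
    have hχ2 := chi_sq_of_mem_primeWindow χ hq hD3 hpW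
    have hneg : χ (-(p : ZMod D)) = χ (-1) * χ (p : ZMod D) := by rw [← map_mul, neg_one_mul]
    rw [hneg]
    have key : ∀ x a y t f m r : ℂ, x * x = 1 →
        x * (a + y * x * t / f * m + r) = x * a + y * t / f * m + x * r := by
      intro x a y t f m r hx
      linear_combination (y * t / f * m) * hx
    exact key _ _ _ _ _ _ _ hχ2
  have hsum : ∑ p ∈ primeWindow D, χ (p : ZMod D) * calS D 1 D p κs as -
      χ (-1) * GammaFactor.tau χ / Nat.totient D * ∑ p ∈ primeWindow D, mainSum14 χ p κs as =
      ∑ p ∈ primeWindow D, χ (p : ZMod D) * princ147 D p κs as +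
      ∑ p ∈ primeWindow D, χ (p : ZMod D) *
        ∑ d ∈ Finset.Icc 1 ⌊2 * P4 D⌋₊, (d : ℂ)⁻¹ * ∑ k ∈ Finset.Icc 1 ⌊2 * P4 D⌋₊,
          as (d * k) / ((k : ℂ) * Nat.totient (D * k)) *
            ∑ θ ∈ finsetOf {θ : DirichletCharacter ℂ (D * k) | θ ≠ 1 ∧ θ ≠ thetaOne χ k},
              tauSum (D * k) θ⁻¹ * θ⁻¹ (p : ZMod (D * k)) *
                ∑' l : ℕ, κs (d * l) * θ (-(l : ZMod (D * k))) *
                  DeltaW D ((l : ℝ) / ((D : ℝ) * p * k)) := by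
    rw [Finset.sum_congr rfl hsplit, Finset.sum_add_distrib, Finset.sum_add_distrib, Finset.mul_sum]
    ring
  rw [hsum]
  -- the principal-character terms
  have hprinc : ‖∑ p ∈ primeWindow D, χ (p : ZMod D) * princ147 D p κs as‖ ≤
      3 * |Ca| * |Cb| * bigP D ^ 2 * Real.log D ^ cb := by
    calc ‖∑ p ∈ primeWindow D, χ (p : ZMod D) * princ147 D p κs as‖
        ≤ ∑ p ∈ primeWindow D, ‖χ (p : ZMod D) * princ147 D p κs as‖ := norm_sum_le _ _
      _ ≤ ∑ p ∈ primeWindow D, |Ca| * |Cb| * bigP D * Real.log D ^ cb := by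
          refine Finset.sum_le_sum fun p hpW => ?_
          rw [norm_mul]
          have h1 := ea p hpW κs as hκ has
          have h2 := eb hA p hpW κs as hκ has
          have hm0 := major1413_nonneg (D := D) p κs as
          have hℓ : 0 ≤ ell D ^ cb := Real.rpow_nonneg (Real.log_natCast_nonneg D) _
          calc ‖χ (p : ZMod D)‖ * ‖princ147 D p κs as‖ ≤ 1 * (Ca * major1413 D p κs as) := by
                gcongr; exact DirichletCharacter.norm_le_one χ _
            _ ≤ |Ca| * major1413 D p κs as := by
                rw [one_mul]; gcongr; exact le_abs_self Ca
            _ ≤ |Ca| * (Cb * bigP D * ell D ^ cb) := by gcongr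
            _ ≤ |Ca| * (|Cb| * bigP D * ell D ^ cb) := by gcongr; exact le_abs_self Cb
            _ = |Ca| * |Cb| * bigP D * Real.log D ^ cb := by rw [ell]; ring
      _ = (primeWindow D).card * (|Ca| * |Cb| * bigP D * Real.log D ^ cb) := by
          rw [Finset.sum_const, nsmul_eq_mul]
      _ ≤ (3 * bigP D) * (|Ca| * |Cb| * bigP D * Real.log D ^ cb) := by
          have hℓ : 0 ≤ Real.log D ^ cb := Real.rpow_nonneg (Real.log_natCast_nonneg D) _
          gcongr; exact card_primeWindow_le hD3
      _ = 3 * |Ca| * |Cb| * bigP D ^ 2 * Real.log D ^ cb := by ring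
  have hrest := norm_sum_window_rest_le χ hD3 hκ as
  have h148 : lhs148 χ κs as ≤ |C₈| * bigP D ^ 2 * (D : ℝ) ^ (-c₈) := by
    refine (e8 hA κs as hκ has).trans ?_
    gcongr; exact le_abs_self C₈
  -- exponents
  have hc4 : 1 / 4 ≤ 1 / 2 - c := by have := min_le_right c₈ (1 / 4); linarith
  have hlog : Real.log D ^ cb ≤ (D : ℝ) ^ (1 / 2 - c) :=
    (hD₁ D hD1).trans (Real.rpow_le_rpow_of_exponent_le hD1' hc4)
  have hDc : (D : ℝ) ^ (-c₈) ≤ (D : ℝ) ^ (1 / 2 - c) :=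
    Real.rpow_le_rpow_of_exponent_le hD1' (by linarith)
  refine (norm_add_le _ _).trans ?_
  refine (add_le_add hprinc (hrest.trans h148)).trans ?_
  have hP2 : 0 ≤ bigP D ^ 2 := sq_nonneg _
  calc 3 * |Ca| * |Cb| * bigP D ^ 2 * Real.log D ^ cb + |C₈| * bigP D ^ 2 * (D : ℝ) ^ (-c₈)
      ≤ 3 * |Ca| * |Cb| * bigP D ^ 2 * (D : ℝ) ^ (1 / 2 - c) +
        |C₈| * bigP D ^ 2 * (D : ℝ) ^ (1 / 2 - c) := by gcongr
    _ = (3 * |Ca| * |Cb| + |C₈|) * bigP D ^ 2 * (D : ℝ) ^ (1 / 2 - c) := by ring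


end Literature.NumberTheory.LFunctions.Zhang2022.Typed.Sec14
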